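import Summits.QuantumFields.GaugeBoot.FrameLayerNetWitness
import Summits.QuantumFields.GaugeBoot.WilsonWeightNegativeBeta
import HarnessLib

/-!
# Link reflection positivity FAILS at every `β < 0` against every gauge-invariant layer network with an odd number of links (gauge-boot, L3 negative supplement; SU(N odd) link reflection at `β < 0`, part 4)

HONEST FRAMING (cell `pub-gaugeboot`, page 1 of every file): the venture produces certified bounds
on lattice expectations at stated coupling, gauge group, dimension and torus size; NOT a mass gap,
NOT a continuum limit, NOT a string tension; NOT Yang–Mills-summit-bearing (barriers
`FixedCouplingUltralocality`, `PerturbativeInvisibility`). This module is a NEGATIVE structural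
result about which reflection-positivity blocks a lattice bootstrap may use at negative coupling;
it bounds no expectation.

`FrameLinkRPNegativeBeta.lean` proved that link (mid-plane) reflection positivity fails at every
`β < 0` for THREE-dimensional representations of determinant one, with the seven-link baryonic theta
graph as the witness. This file abstracts the computation to its actual content. Periodic lattice
`(A, e)` with a site frame `IsSiteFrame e k σ Q h` (`Q ≥ 2`); `G` compact second countable;
`ρ : G → M_N(ℂ)` continuous with `det ρ ≡ 1`, scalar commutant and `ρ ≢ 1`; a **layer network**
(`LayerNetObservable.lean`): distinct links `t : J → Link A d` of height `1` and directions `≠ k`,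
a value function `Ω` with an entry expansion (multi-affine in the oriented link matrices), gauge
invariant on the lowered links, `Ω(1) ≠ 0`. Then:

* **`IsSiteFrame.linkRP_integral_conj_mul_net_eq`** — the EXACT VALUE
  `∫ conj F(ΘU) F(U) dμ_β = (e^{-Nβ#P}/Z) · z^{|S|-|J|} c_β^{|J|} · ∫ |netObs_low|² dμ₀ · ∫ (upper slab) dμ₀`
  for the witness `F = netObs · exp(-β A)` (`netWitness`), `c_β` the scalar `wAvg` of the one-link
  Wilson weight — every real `β`;
* **`IsSiteFrame.linkRP_integral_conj_mul_net_neg_of_neg`** — for `β < 0` (`c_β < 0`,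
  `WilsonWeightNegativeBeta.lean`) and `|J|` ODD the value is `< 0`;
* **`IsSiteFrame.not_linkRP_of_neg_of_oddNet`** — closed-half link reflection positivity in the
  shape of `IsSiteFrame.linkRP_integral_conj_mul_nonneg` is FALSE at every `β < 0` as soon as the
  layer `1` carries such a network.

Transfer-matrix reading: a gauge-invariant spin network of the transverse slice built from `|J|`
single fundamental links is an eigenfunction of the gauge-averaged one-step kernel with eigenvalue
`∝ c_β^{|J|}`; on a bipartite slice Wilson loops have even length, but for `det ρ = 1`, `N` odd, the
`N`-leg baryon–antibaryon star between ADJACENT sites has `6n+1` links (`BaryonStarObservable.lean`).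
Instances: `CubicTorusLinkRPNegativeBetaOdd.lean` (`SU(N)`, `N` odd, `3 ≤ N ≤ 2d-3`).

References: K. Osterwalder, E. Seiler, Ann. Phys. 110 (1978) 440, §2; E. Seiler, LNP 159 (1982)
Ch. 2; M. Creutz, Quarks, Gluons and Lattices (1983) Ch. 8; I. Montvay, G. Münster, Quantum Fields
on a Lattice (1994) §4.2.
-/

noncomputable section

open MeasureTheory Complex
open scoped Matrix ComplexConjugate ComplexOrder
open Literature.MathematicalPhysics.QuantumFieldTheory (haarProbability)
open Literature.MathematicalPhysics.QuantumFieldTheory.LatticeRP (integral_mul_eq_of_dependsOn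
  integral_comp_eq_of_measurePreserving)
open Literature.RepresentationTheory.CompactGroups

namespace Summit.QuantumFields.GaugeBoot

namespace TiltedRP

open Baryon TwistedSlab LayerNet

namespace IsSiteFrame

variable {A : Type*} [AddCommGroup A] [Fintype A] {d N : ℕ}
variable {e : Fin d → A} {k : Fin d} {σ : A →+ A} {Q : ℕ} {h : A →+ ZMod (2 * Q)}
variable (hF : IsSiteFrame e k σ Q h)
include hF
variable {G : Type*} [Group G] (ρ : G →* Matrix (Fin N) (Fin N) ℂ)

/-! ## The Boltzmann weight against the witness -/

variable [TopologicalSpace G] [IsTopologicalGroup G] [CompactSpace G]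

open scoped Classical in
/-- **The Boltzmann weight against the witness**: pointwise,
`e^{-βS(U)} · e^{-βA(ΘU)} · e^{-βA(U)} = e^{-βN#P} · (lower slab weights on the block) · (upper slab)`.
[folklore] -/
theorem boltzmann_mul_netWeights (hρ : Continuous ρ) (β : ℝ) (U : Config A d G) :
    Real.exp (-β * wilsonAction ρ e U) *
        (Real.exp (-(β * posAction ρ e k Q h (configMidReflect e k σ U))) *
          Real.exp (-(β * posAction ρ e k Q h U))) =
      Real.exp (-(β * (N * Fintype.card (Plaq A d)))) *
        ((∏ t ∈ lowerBlock k Q h,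
            TwistedSlab.wilsonWeight ρ β (lowerA e k Q h t U * (U t)⁻¹ * lowerB e k Q h t U)) *
          ∏ p ∈ Finset.univ.filter (IsUpperPlaq k Q h), Real.exp (β * plaqObs ρ e p U)) := by
  rw [← hF.prod_exp_lower_eq ρ hρ β U, ← Real.exp_add, ← Real.exp_add, wilsonAction_eq,
    hF.sum_plaqObs_split_mid ρ hρ U, hF.sum_cross_eq_sum_lower_add_sum_upper]
  have h1 : ∀ s : Finset (Plaq A d), ∏ p ∈ s, Real.exp (β * plaqObs ρ e p U) =
      Real.exp (β * ∑ p ∈ s, plaqObs ρ e p U) := fun s => by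
    rw [Finset.mul_sum, Real.exp_sum]
  rw [h1, h1, ← Real.exp_add, ← Real.exp_add]
  congr 1
  unfold posAction
  ring

/-! ## The main computation -/

variable [MeasurableSpace G] [BorelSpace G] [SecondCountableTopology G] [DecidableEq A]
variable {J : Type*} [Fintype J] {t : J → Link A d} {o : J → Bool} {Ω : (J → G) → ℂ}
  {I : Type*} [Fintype I] {κ : I → ℂ} {γ δ : J → I → Fin N}

/-- **THE VALUE OF THE REFLECTION-POSITIVITY INTEGRAL AGAINST A LAYER NETWORK.** Periodic lattice
`(A, e)` with a site frame `IsSiteFrame e k σ Q h`; `G` compact second countable; `ρ : G → M_N(ℂ)`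
continuous with `det ρ(g) = 1` and scalar `c` with `wAvg ρ w_β = c • 1` (`w_β` the one-link Wilson
weight); a layer network: distinct links `t j` of height `1` and directions `≠ k`, value function
`Ω` with an entry expansion and gauge invariant on the lowered links. Then for the witness
`F = netWitness` and every real `β`:
`∫ conj F(ΘU) F(U) dμ_β = (e^{-Nβ#P}/Z) · (z^{|S|-|J|} c^{|J|} ∫ |netObs_low|² dμ₀) · ∫ (upper slab) dμ₀`.
[folklore] -/
theorem linkRP_integral_conj_mul_net_eq (hρ : Continuous ρ) (hdet : ∀ g, (ρ g).det = 1)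
    (hinj : Function.Injective t) (ht1 : ∀ j, (h (t j).1).val = 1) (htk : ∀ j, (t j).2 ≠ k)
    (hΩ : IsEntryExpansion ρ o Ω κ γ δ) (hG : IsGaugeInvariant ρ e (lowerLink e k t) Ω)
    (β : ℝ) {c : ℝ} (hc : wAvg ρ (TwistedSlab.wilsonWeight ρ β) = ((c : ℂ)) • (1 : Matrix (Fin N) (Fin N) ℂ)) :
    ∫ U, conj (netWitness ρ e k Q h β t Ω (configMidReflect e k σ U)) *
        netWitness ρ e k Q h β t Ω U ∂(gibbs ρ e β) =
      ((Real.exp (-(β * (N * Fintype.card (Plaq A d)))) /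
          (∫ U, Real.exp (-β * wilsonAction ρ e U) ∂(productHaar A d G)) *
        ((∫ g, TwistedSlab.wilsonWeight ρ β g ∂(haarProbability G)) ^
            ((lowerBlock k Q h).card - Fintype.card J) * c ^ Fintype.card J *
          (∫ U, ‖netObs (lowerLink e k t) Ω U‖ ^ 2 ∂(productHaar A d G)) *
          ∫ U, ∏ p ∈ Finset.univ.filter (IsUpperPlaq k Q h), Real.exp (β * plaqObs ρ e p U)
            ∂(productHaar A d G)) : ℝ) : ℂ) := by
  classical
  haveI := TwistedSlab.isProbabilityMeasure_productHaar' (A := A) (d := d) (G := G)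
  have hQ := hF.two_le
  have hΩc : Continuous Ω := hΩ.continuous ρ hρ
  have hx₀0 : ∀ j, (h (lowerLink e k t j).1).val = 0 := hF.val_height_lowerLink ht1
  -- the constants
  have hwc := TwistedSlab.continuous_wilsonWeight ρ hρ β
  have hwinv := TwistedSlab.wilsonWeight_inv ρ hρ β
  have hzr : ∫ g, (TwistedSlab.wilsonWeight ρ β g : ℂ) ∂(haarProbability G) =
      ((∫ g, TwistedSlab.wilsonWeight ρ β g ∂(haarProbability G) : ℝ) : ℂ) := integral_complex_ofReal
  -- Step A: against the product Haar measure
  have hrefl : ∀ U : Config A d G,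
      netObs t Ω (configMidReflect e k σ U) = netObs (lowerLink e k t) Ω U :=
    fun U => hF.netObs_configMidReflect ht1 htk Ω U
  have hA : ∫ U, conj (netWitness ρ e k Q h β t Ω (configMidReflect e k σ U)) *
        netWitness ρ e k Q h β t Ω U ∂(gibbs ρ e β) =
      ((Real.exp (-(β * (N * Fintype.card (Plaq A d)))) /
          ∫ U, Real.exp (-β * wilsonAction ρ e U) ∂(productHaar A d G) : ℝ) : ℂ) *
        ∫ U, conj (netObs (lowerLink e k t) Ω U) * netObs t Ω U *
          (∏ s ∈ lowerBlock k Q h, (TwistedSlab.wilsonWeight ρ β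
            (lowerA e k Q h s U * (U s)⁻¹ * lowerB e k Q h s U) : ℂ)) *
          ((∏ p ∈ Finset.univ.filter (IsUpperPlaq k Q h), Real.exp (β * plaqObs ρ e p U) : ℝ) : ℂ)
          ∂(productHaar A d G) := by
    rw [integral_gibbs, ← integral_const_mul]
    refine integral_congr_ae (ae_of_all _ fun U => ?_)
    have hw := congrArg (fun r : ℝ => (r : ℂ)) (hF.boltzmann_mul_netWeights ρ hρ β U)
    push_cast at hw
    simp only [netWitness, map_mul, Complex.conj_ofReal, Complex.real_smul, hrefl U]
    push_cast
    linear_combination (conj (netObs (lowerLink e k t) Ω U) * netObs t Ω U /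
      ((∫ U, Real.exp (-β * wilsonAction ρ e U) ∂(productHaar A d G) : ℝ) : ℂ)) * hw
  -- Step B: the upper slab is an independent factor
  have hdep1 : ∀ (U V : Config A d G),
      (∀ s ∈ ((Finset.univ.filter fun s : Link A d => (h s.1).val = 0 ∨ (h s.1).val = 1 :
        Finset (Link A d)) : Set (Link A d)), U s = V s) → netObs t Ω U = netObs t Ω V := by
    intro U V hUV
    refine netObs_congr fun j => hUV _ ?_
    rw [Finset.coe_filter]
    exact ⟨Finset.mem_univ _, Or.inr (ht1 j)⟩
  have hdep0 : ∀ (U V : Config A d G),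
      (∀ s ∈ ((Finset.univ.filter fun s : Link A d => (h s.1).val = 0 ∨ (h s.1).val = 1 :
        Finset (Link A d)) : Set (Link A d)), U s = V s) →
      netObs (lowerLink e k t) Ω U = netObs (lowerLink e k t) Ω V := by
    intro U V hUV
    refine netObs_congr fun j => hUV _ ?_
    rw [Finset.coe_filter]
    exact ⟨Finset.mem_univ _, Or.inl (hx₀0 j)⟩
  have hfc : Continuous fun U : Config A d G => conj (netObs (lowerLink e k t) Ω U) *
      netObs t Ω U * ∏ s ∈ lowerBlock k Q h, (TwistedSlab.wilsonWeight ρ β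
        (lowerA e k Q h s U * (U s)⁻¹ * lowerB e k Q h s U) : ℂ) :=
    ((continuous_conj.comp (continuous_netObs _ hΩc)).mul
      (continuous_netObs t hΩc)).mul (continuous_lowerProd (k := k) (Q := Q) (h := h) ρ hρ β)
  have hupc : Continuous fun U : Config A d G =>
      ∏ p ∈ Finset.univ.filter (IsUpperPlaq k Q h), Real.exp (β * plaqObs ρ e p U) :=
    continuous_exp_upper (k := k) (Q := Q) (h := h) ρ hρ β
  have hB : ∫ U, conj (netObs (lowerLink e k t) Ω U) * netObs t Ω U *
          (∏ s ∈ lowerBlock k Q h, (TwistedSlab.wilsonWeight ρ β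
            (lowerA e k Q h s U * (U s)⁻¹ * lowerB e k Q h s U) : ℂ)) *
          ((∏ p ∈ Finset.univ.filter (IsUpperPlaq k Q h), Real.exp (β * plaqObs ρ e p U) : ℝ) : ℂ)
          ∂(productHaar A d G) =
      (∫ U, conj (netObs (lowerLink e k t) Ω U) * netObs t Ω U *
          ∏ s ∈ lowerBlock k Q h, (TwistedSlab.wilsonWeight ρ β
            (lowerA e k Q h s U * (U s)⁻¹ * lowerB e k Q h s U) : ℂ) ∂(productHaar A d G)) *
        ∫ U, ((∏ p ∈ Finset.univ.filter (IsUpperPlaq k Q h), Real.exp (β * plaqObs ρ e p U) : ℝ) : ℂ)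
          ∂(productHaar A d G) := by
    unfold productHaar
    refine integral_mul_eq_of_dependsOn (haarProbability G)
      (Finset.univ.filter fun s : Link A d => (h s.1).val = 0 ∨ (h s.1).val = 1)
      (Finset.univ.filter fun s : Link A d => ¬ ((h s.1).val = 0 ∨ (h s.1).val = 1))
      (Finset.disjoint_filter.2 fun s _ hs hns => hns hs) hfc.measurable
      (continuous_ofReal.comp hupc).measurable (fun U V hUV => ?_) (fun U V hUV => ?_)
    · rw [hdep0 U V hUV, hdep1 U V hUV]
      congr 1
      refine Finset.prod_congr rfl fun s hs => ?_
      have h0 : (h (s.1 - e k)).val = 0 := hF.val_height_base_of_mem hs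
      have h0' : (h (s.1 - e k + e s.2)).val = 0 := by
        rw [hF.height_add_other _ (mem_lowerBlock.1 hs).2, h0]
      have hmem : ∀ s' : Link A d, (h s'.1).val = 0 ∨ (h s'.1).val = 1 →
          s' ∈ ((Finset.univ.filter fun s : Link A d => (h s.1).val = 0 ∨ (h s.1).val = 1 :
            Finset (Link A d)) : Set (Link A d)) :=
        fun s' hs' => by rw [Finset.coe_filter]; exact ⟨Finset.mem_univ _, hs'⟩
      have hblk : IsLowerBlockLink k Q h s := mem_lowerBlock.1 hs
      simp only [lowerA, lowerB, if_pos hblk]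
      rw [hUV s (hmem s (Or.inr hblk.1)), hUV _ (hmem (s.1 - e k, s.2) (Or.inl h0)),
        hUV _ (hmem (s.1 - e k + e s.2, k) (Or.inl h0')), hUV _ (hmem (s.1 - e k, k) (Or.inl h0))]
    · refine congrArg (fun r : ℝ => (r : ℂ)) (hF.dependsOn_exp_upper ρ hρ β (fun s hs => hUV s ?_))
      rw [Finset.coe_filter]
      exact ⟨Finset.mem_univ _, fun h' => h'.elim hs.1 hs.2⟩
  have hup_int : ∫ U, ((∏ p ∈ Finset.univ.filter (IsUpperPlaq k Q h),
        Real.exp (β * plaqObs ρ e p U) : ℝ) : ℂ) ∂(productHaar A d G) =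
      ((∫ U, ∏ p ∈ Finset.univ.filter (IsUpperPlaq k Q h), Real.exp (β * plaqObs ρ e p U)
        ∂(productHaar A d G) : ℝ) : ℂ) := integral_complex_ofReal
  -- Step C: transfer the network of the layer `1` down through the lower slab
  have hθ₀dep : DependsOn (fun U : Config A d G => conj (netObs (lowerLink e k t) Ω U))
      (((lowerBlock k Q h)ᶜ : Finset (Link A d)) : Set (Link A d)) := by
    intro U V hUV
    dsimp only
    rw [netObs_congr (t' := lowerLink e k t) (U' := V) fun j => hUV _ ?_]
    rw [Finset.coe_compl, Set.mem_compl_iff, Finset.mem_coe]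
    intro hmem
    have h1 := (mem_lowerBlock.1 hmem).1
    rw [hx₀0 j] at h1
    exact absurd h1 (by omega)
  have hC₁ : ∫ U, conj (netObs (lowerLink e k t) Ω U) * netObs t Ω U *
        ∏ s ∈ lowerBlock k Q h, (TwistedSlab.wilsonWeight ρ β
          (lowerA e k Q h s U * (U s)⁻¹ * lowerB e k Q h s U) : ℂ) ∂(productHaar A d G) =
      (∫ g, (TwistedSlab.wilsonWeight ρ β g : ℂ) ∂(haarProbability G)) ^
          ((lowerBlock k Q h).card - Fintype.card J) *
        (c : ℂ) ^ Fintype.card J * ∫ U, conj (netObs (lowerLink e k t) Ω U) *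
          netObs t Ω (fun s => lowerB e k Q h s U * lowerA e k Q h s U) ∂(productHaar A d G) :=
    net_slab_integral_frozen ρ hwc hwinv hc hρ hΩ t (lowerBlock k Q h) (lowerA e k Q h)
      (lowerB e k Q h) (fun s => continuous_lowerA s) (fun s => continuous_lowerB s)
      (fun s => hF.dependsOn_lowerA s) (fun s => dependsOn_lowerB s) _
      (continuous_conj.comp (continuous_netObs _ hΩc)) hθ₀dep hinj
      (fun j => net_mem_lowerBlock ht1 htk j)
  have hC₂ : ∀ U : Config A d G,
      netObs t Ω (fun s => lowerB e k Q h s U * lowerA e k Q h s U) = netObs (lowerLink e k t) Ω U :=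
    fun U => netObs_transfer ρ ht1 htk hG hdet U
  simp_rw [hC₂] at hC₁
  -- Step D: assemble
  have hsq := integral_conj_netObs_mul_self (lowerLink e k t) Ω (A := A) (G := G)
  rw [hA, hB, hC₁, hzr, hup_int, hsq]
  push_cast
  ring

/-- **LINK REFLECTION POSITIVITY FAILS AT EVERY `β < 0` AGAINST EVERY GAUGE-INVARIANT LAYER NETWORK
WITH AN ODD NUMBER OF LINKS.** Periodic lattice `(A, e)` with a site frame `IsSiteFrame e k σ Q h`;
`G` compact second countable, `ρ : G → M_N(ℂ)` continuous with `det ρ(g) = 1`, scalar commutant and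
`ρ ≢ 1`; a layer network (distinct links `t j` of height `1`, directions `≠ k`; value function with an
entry expansion, gauge invariant on the lowered links, `Ω(1) ≠ 0`) with `|J|` ODD. Then for every
`β < 0` the witness `F = netWitness` (bounded, continuous, an observable of the closed half
`{1 ≤ h ≤ Q}`) has `∫ conj F(ΘU) · F(U) dμ_β(U) < 0`, `Θ = configMidReflect e k σ`,
`μ_β = gibbs ρ e β`. -/
theorem linkRP_integral_conj_mul_net_neg_of_neg (hρ : Continuous ρ)
    (hirr : TwistedSlab.HasScalarCommutant ρ) (hρ1 : ∃ g, ρ g ≠ 1) (hdet : ∀ g, (ρ g).det = 1)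
    (hinj : Function.Injective t) (ht1 : ∀ j, (h (t j).1).val = 1) (htk : ∀ j, (t j).2 ≠ k)
    (hΩ : IsEntryExpansion ρ o Ω κ γ δ) (hG : IsGaugeInvariant ρ e (lowerLink e k t) Ω)
    (hΩ1 : Ω (fun _ => 1) ≠ 0) (hodd : Odd (Fintype.card J)) {β : ℝ} (hβ : β < 0) :
    ∫ U, conj (netWitness ρ e k Q h β t Ω (configMidReflect e k σ U)) *
        netWitness ρ e k Q h β t Ω U ∂(gibbs ρ e β) < 0 := by
  classical
  haveI := TwistedSlab.isProbabilityMeasure_productHaar' (A := A) (d := d) (G := G)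
  have hN : 1 ≤ N := by
    rcases Nat.eq_zero_or_pos N with h0 | h0
    · exfalso
      obtain ⟨g, hg⟩ := hρ1
      subst h0
      exact hg (Subsingleton.elim _ _)
    · exact h0
  have hΩc : Continuous Ω := hΩ.continuous ρ hρ
  obtain ⟨c, hcneg, hc⟩ := TwistedSlab.wAvg_wilsonWeight_eq_smul_neg ρ hirr hρ hρ1 hβ hN
  have hwc := TwistedSlab.continuous_wilsonWeight ρ hρ β
  have hzpos : 0 < ∫ g, TwistedSlab.wilsonWeight ρ β g ∂(haarProbability G) := by
    have hint : Integrable (TwistedSlab.wilsonWeight ρ β) (haarProbability G) :=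
      hwc.integrable_of_hasCompactSupport (HasCompactSupport.of_compactSpace _)
    rw [integral_pos_iff_support_of_nonneg (fun g => (TwistedSlab.wilsonWeight_pos ρ β g).le) hint]
    have : Function.support (TwistedSlab.wilsonWeight ρ β) = Set.univ :=
      Set.eq_univ_of_forall fun g => (TwistedSlab.wilsonWeight_pos ρ β g).ne'
    rw [this, measure_univ]; exact one_pos
  have hZ := normaliser_pos (A := A) (G := G) ρ hρ e β
  have hC₀pos : 0 < Real.exp (-(β * (N * Fintype.card (Plaq A d)))) := Real.exp_pos _
  have hupc : Continuous fun U : Config A d G =>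
      ∏ p ∈ Finset.univ.filter (IsUpperPlaq k Q h), Real.exp (β * plaqObs ρ e p U) :=
    continuous_exp_upper (k := k) (Q := Q) (h := h) ρ hρ β
  have hup_pos : 0 < ∫ U, ∏ p ∈ Finset.univ.filter (IsUpperPlaq k Q h),
      Real.exp (β * plaqObs ρ e p U) ∂(productHaar A d G) := by
    have hint := TwistedSlab.integrable_config_of_continuous hupc
    rw [integral_pos_iff_support_of_nonneg
      (fun U => (exp_upper_pos (k := k) (Q := Q) (h := h) ρ β U).le) hint]
    have : (Function.support fun U : Config A d G =>
        ∏ p ∈ Finset.univ.filter (IsUpperPlaq k Q h), Real.exp (β * plaqObs ρ e p U)) = Set.univ :=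
      Set.eq_univ_of_forall fun U => (exp_upper_pos (k := k) (Q := Q) (h := h) ρ β U).ne'
    rw [this, measure_univ]; exact one_pos
  have hsq_pos := integral_normSq_netObs_pos (lowerLink e k t) hΩc hΩ1 (A := A) (G := G)
  rw [hF.linkRP_integral_conj_mul_net_eq ρ hρ hdet hinj ht1 htk hΩ hG β hc]
  have hcJ : c ^ Fintype.card J < 0 := Odd.pow_neg hodd hcneg
  have hfin : Real.exp (-(β * (N * Fintype.card (Plaq A d)))) /
      (∫ U, Real.exp (-β * wilsonAction ρ e U) ∂(productHaar A d G)) *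
      ((∫ g, TwistedSlab.wilsonWeight ρ β g ∂(haarProbability G)) ^
          ((lowerBlock k Q h).card - Fintype.card J) * c ^ Fintype.card J *
        (∫ U, ‖netObs (lowerLink e k t) Ω U‖ ^ 2 ∂(productHaar A d G)) *
        ∫ U, ∏ p ∈ Finset.univ.filter (IsUpperPlaq k Q h), Real.exp (β * plaqObs ρ e p U)
          ∂(productHaar A d G)) < 0 :=
    mul_neg_of_pos_of_neg (div_pos hC₀pos hZ) (mul_neg_of_neg_of_pos
      (mul_neg_of_neg_of_pos (mul_neg_of_pos_of_neg (pow_pos hzpos _) hcJ) hsq_pos) hup_pos)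
  exact_mod_cast hfin

/-- **Corollary: closed-half LINK reflection positivity, in the shape of
`IsSiteFrame.linkRP_integral_conj_mul_nonneg`, is FALSE at every `β < 0`** for a continuous
`N`-dimensional representation with `det ρ ≡ 1`, scalar commutant and `ρ ≢ 1` of a compact second
countable group, on any periodic lattice with a site frame whose layer `1` carries a gauge-invariant
layer network with an entry expansion, `Ω(1) ≠ 0` and an ODD number of distinct links. -/
theorem not_linkRP_of_neg_of_oddNet (hρ : Continuous ρ) (hirr : TwistedSlab.HasScalarCommutant ρ)
    (hρ1 : ∃ g, ρ g ≠ 1) (hdet : ∀ g, (ρ g).det = 1)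
    (hinj : Function.Injective t) (ht1 : ∀ j, (h (t j).1).val = 1) (htk : ∀ j, (t j).2 ≠ k)
    (hΩ : IsEntryExpansion ρ o Ω κ γ δ) (hG : IsGaugeInvariant ρ e (lowerLink e k t) Ω)
    (hΩ1 : Ω (fun _ => 1) ≠ 0) (hodd : Odd (Fintype.card J)) {β : ℝ} (hβ : β < 0) :
    ¬ ∀ F : Config A d G → ℂ, Measurable F → (∃ C : ℝ, ∀ U, ‖F U‖ ≤ C) →
        IsMidObservable e Q h F →
        0 ≤ ∫ U, conj (F (configMidReflect e k σ U)) * F U ∂(gibbs ρ e β) := by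
  intro hall
  have hΩc : Continuous Ω := hΩ.continuous ρ hρ
  have hneg := hF.linkRP_integral_conj_mul_net_neg_of_neg ρ hρ hirr hρ1 hdet hinj ht1 htk hΩ hG hΩ1
    hodd hβ
  have hpos := hall (netWitness ρ e k Q h β t Ω)
    (continuous_netWitness ρ e k Q h hρ β t hΩc).measurable
    (exists_norm_netWitness_le ρ e k Q h hρ β t hΩc) (hF.isMidObservable_netWitness ρ ht1 htk Ω β)
  exact absurd hpos (not_le_of_gt hneg)

end IsSiteFrame

end TiltedRP

end Summit.QuantumFields.GaugeBoot

end
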